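import Literature.Barriers.NavierStokesRegularity.ComplexNavierStokesBlowupSeriesTilt
import Literature.NumberTheory.Transcendental.ChudnovskyHeights
import Mathlib.LinearAlgebra.Lagrange
import Mathlib.MeasureTheory.Integral.Lebesgue.Markov
import Mathlib.MeasureTheory.Measure.Prod
import Mathlib.Analysis.Complex.ExponentialBounds
import Mathlib.Analysis.SpecialFunctions.Pow.Real
import Mathlib.Data.Nat.Choose.Sum
import Mathlib.Topology.Algebra.Polynomial
import HarnessLib

/-!
# Li–Sinai complex Navier–Stokes blow-up: a single-mode criterion for infinite energy

Sixth file of the barrier entry `ComplexNavierStokesBlowup` (D-0021), companion of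
`ComplexNavierStokesBlowupSeries.lean` (the power series (3) of D. Li, Ya. G. Sinai, *Blow ups of
complex solutions of the 3D Navier–Stokes system and renormalization group method*, J. Eur. Math.
Soc. 10 (2008) 267–313, §2, PROVED there to solve the integral equation (1) at all times), of
`ComplexNavierStokesBlowupSeriesEnergy.lean` (finite energy for small times, PROVED; the named
fact `LiSinaiSeriesEnergyInfinite` = infinite energy of the series solution at one time for one
admissible datum — the unproved core, implying the narrowed catalogue form
`LiSinaiCriticalEnergyBlowupNarrow`) and of `ComplexNavierStokesBlowupSeriesTilt.lean`
(exponential tilts; the tail-energy criterion). Everything in this file is PROVED; no new fact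
is stated. (Fourier space is written `EuclideanSpace ℝ (Fin 3)`; `k 2` is the third coordinate
`k₃`; `mode v₀ p t` is the `p`-th term of the series (3)/(46) at time `t`.)

## What is here

The source infers the infinite energy at the critical time from the size of the INDIVIDUAL terms
of the series: "`A^p g_p(k, t)` is concentrated in the domain with center at `κ⁽⁰⁾p/√t` having
the size `O(√p)` and there it takes values `O(p)`. This immediately implies that at `t` the
energy is infinite" [LiSinai2008, §10 p. 312], the sizes coming from Theorem 1 (p. 311). Since
the supports `C + ⋯ + C` of the terms [LiSinai2008, §2 p. 270] of neighbouring orders `p`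
overlap, the inference has to cope with cancellations between different orders (such
cancellations do occur for positive amplitude [BoldrighiniEtAl2023, §2 p. 114: "cancellations
between terms of the series (2.8) with neighboring `p`, which for the fixed point `H₀` holds
for positive `A`"]). This file PROVES a version of the inference that needs no information on
signs or shapes:

* `LiSinaiSeriesEnergyInfinite.of_modeLowerBound` (**single-mode criterion**): if for ONE
  admissible datum `v₀` (measurable, bounded, vanishing off `{a ≤ k₃, |k| ≤ R}` with `a > 0`,
  incompressible), one time `t > 0` and some `ρ, σ > 0` the single modes satisfy
  `vol {k : ‖mode v₀ n t k‖ ≥ ρⁿ} ≥ σⁿ` for infinitely many `n` — i.e. the `n`-th term of the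
  series is not super-exponentially small in measure — then `LiSinaiSeriesEnergyInfinite` holds
  (witnessed by a datum `A e^{μ k₃} v₀(k)` with suitable `A ∈ [1, 2]`, `μ ≥ 0`), hence so does
  `LiSinaiCriticalEnergyBlowupNarrow` (`LiSinaiCriticalEnergyBlowupNarrow.of_modeLowerBound`).

So, for the purpose of the barrier, Theorem 1 of the source may be replaced by ANY geometric
lower bound, in measure, on single terms of the explicit series for one admissible datum at one
time; cancellations between different terms are provably irrelevant. No such lower bound is
proved here: for the tuned data of the source it is assertion (a₁) of Theorem 1, whose printed
proof is the renormalisation-group construction of §§3–9 with computer-numerical steps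
(§7 p. 302).

## Proof (ours; elementary)

For `A ∈ ℝ` the series solution of the datum `A v₀` at `k` is the polynomial
`Σ_{q < N} A^q mode v₀ q t k` (`mode_smul`, `seriesSolution_eq_sum`), of degree `< N ≤ nR/a + 1`
on the set `G_n = {‖mode v₀ n t k‖ ≥ ρⁿ} ⊆ {na ≤ k₃ ≤ nR}`, and its scalar product with
`mode v₀ n t k` has `n`-th coefficient `‖mode v₀ n t k‖²`.
(1) A Turán–Remez-type lemma (`LiSinai.abs_coeff_le_of_volume_sublevel`): a real polynomial of
degree `≤ D` which is `≤ ε` in absolute value on a subset of `[1, 2]` of measure `≥ 1/4` has all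
coefficients `≤ 3 · 72^D · ε` (choose `D + 1` points of the sublevel set with gaps
`≥ (j - i)/(4(D+1))` by the distribution function `x ↦ vol(S ∩ (-∞, x])`, then Lagrange
interpolation: the basis polynomials have coefficient-`ℓ¹`-norm `≤ 3^D/(δ^D i!(D-i)!)`).
(2) Hence at `k ∈ G_n` the set of amplitudes `A ∈ [1, 2]` at which the `e^{μ k₃}`-tilted
solution has norm `≤ ε_n` has measure `< 1/4`, once `ρⁿ e^{μ n a} > 3 · 72^{nR/a} ε_n`.
(3) Fubini on `[1,2] × G_n` and Markov's inequality: outside a set of amplitudes of measure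
`≤ 1/2`, the tilted solution exceeds `ε_n` on half of `G_n`, so its energy on `G_n` is
`≥ ε_n² σⁿ / 2 = 1` for `ε_n² = 2 σ⁻ⁿ`.
(4) Along a sparse subsequence (`n_{j+1} a > n_j R`, making the `G`'s disjoint) the good
amplitude sets have a limsup of measure `≥ 1/2`, so one amplitude `A⋆` is good for infinitely
many `n_j`; the weighted energy of `A⋆ v₀` is then infinite, and
`LiSinaiSeriesEnergyInfinite.of_expTilt` applies. The tilt `μ` is chosen with
`ρ e^{μ a} √σ ≥ 5 · 72^{R/a}`.

## References

* D. Li, Ya. G. Sinai, J. Eur. Math. Soc. 10 (2008) 267–313: §2 p. 269–270 (eqs. (3)–(6),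
  `supp g_p`), §7 p. 302, Thm. 1 p. 311, §10 p. 312 (eq. (46), first paragraph).
  [`LiSinai2008`]
* C. Boldrighini, S. Frigio, P. Maponi, A. Pellegrinotti, Ya. G. Sinai, *Real and complex
  Li–Sinai solutions of the 3D incompressible Navier–Stokes equations*, Ensaios Mat. 38 (2023)
  105–125, §2 (Thm. 2.2 p. 113 and p. 114). [`BoldrighiniEtAl2023`]
-/

noncomputable section

open MeasureTheory Set Filter Topology Finset Polynomial
open scoped ENNReal InnerProductSpace RealInnerProductSpace BigOperators Nat

namespace Literature.Barriers.NavierStokesRegularity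

namespace LiSinai

open Literature.NumberTheory.Transcendental.Chudnovsky (pwnorm pwnorm_mul_le pwnorm_C
  pwnorm_X_sub_C_le pwnorm_nonneg le_pwnorm pwnorm_prod_le)

/-! ### A Turán–Remez-type lemma for real polynomials -/

/-- **Separated nodes in a set of positive measure.** If `S ⊆ [1, 2]` is closed with Lebesgue
measure `≥ λ > 0`, then for every `D` there are points `x₀ ≤ x₁ ≤ ⋯ ≤ x_D` of `S` with
`x_j - x_i ≥ (j - i) λ/(D+1)`: take `x_i` the least point of `S` at which the distribution
function `F(x) = vol(S ∩ (-∞, x])` reaches `(i + ½) λ/(D+1)`; `F` is `1`-Lipschitz and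
`F(x_i)` is exactly this level. [folklore] -/
theorem exists_separated_nodes {S : Set ℝ} (hS : IsClosed S) (hS12 : S ⊆ Set.Icc (1 : ℝ) 2)
    {lam : ℝ} (hlam : 0 < lam) (hvol : ENNReal.ofReal lam ≤ volume S) (D : ℕ) :
    ∃ x : ℕ → ℝ, (∀ i ≤ D, x i ∈ S) ∧
      ∀ i j : ℕ, i < j → j ≤ D → ((j : ℝ) - i) * (lam / (D + 1)) ≤ x j - x i := by
  classical
  have hSfin : volume S ≠ ∞ := by
    refine ne_top_of_le_ne_top (b := volume (Set.Icc (1 : ℝ) 2)) ?_ (measure_mono hS12)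
    rw [Real.volume_Icc]
    exact ENNReal.ofReal_ne_top
  have hfin : ∀ x, volume (S ∩ Set.Iic x) ≠ ∞ := fun x =>
    ne_top_of_le_ne_top hSfin (measure_mono Set.inter_subset_left)
  -- the distribution function of `S`
  set F : ℝ → ℝ := fun x => (volume (S ∩ Set.Iic x)).toReal with hF
  have hF_mono : Monotone F := fun x y hxy =>
    ENNReal.toReal_mono (hfin y)
      (measure_mono (Set.inter_subset_inter_right _ (Set.Iic_subset_Iic.2 hxy)))
  have hF_sub : ∀ x y, x ≤ y → F y - F x ≤ y - x := by
    intro x y hxy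
    have hsub : S ∩ Set.Iic y ⊆ (S ∩ Set.Iic x) ∪ Set.Ioc x y := by
      intro z hz
      by_cases hzx : z ≤ x
      · exact Or.inl ⟨hz.1, hzx⟩
      · exact Or.inr ⟨not_le.1 hzx, hz.2⟩
    have h1 : volume (S ∩ Set.Iic y) ≤ volume (S ∩ Set.Iic x) + ENNReal.ofReal (y - x) :=
      calc volume (S ∩ Set.Iic y) ≤ volume ((S ∩ Set.Iic x) ∪ Set.Ioc x y) := measure_mono hsub
        _ ≤ volume (S ∩ Set.Iic x) + volume (Set.Ioc x y) := measure_union_le _ _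
        _ = volume (S ∩ Set.Iic x) + ENNReal.ofReal (y - x) := by rw [Real.volume_Ioc]
    have h2 := ENNReal.toReal_mono (ENNReal.add_ne_top.2 ⟨hfin x, ENNReal.ofReal_ne_top⟩) h1
    rw [ENNReal.toReal_add (hfin x) ENNReal.ofReal_ne_top,
      ENNReal.toReal_ofReal (sub_nonneg.2 hxy)] at h2
    simp only [hF]
    linarith
  have hF_cont : Continuous F := by
    refine (LipschitzWith.of_dist_le_mul (K := 1) fun x y => ?_).continuous
    rw [NNReal.coe_one, one_mul, Real.dist_eq, Real.dist_eq]
    rcases le_total x y with hxy | hxy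
    · rw [abs_of_nonpos (sub_nonpos.2 (hF_mono hxy)), abs_of_nonpos (sub_nonpos.2 hxy)]
      linarith [hF_sub x y hxy]
    · rw [abs_of_nonneg (sub_nonneg.2 (hF_mono hxy)), abs_of_nonneg (sub_nonneg.2 hxy)]
      linarith [hF_sub y x hxy]
  -- `S` is nonempty with a largest element, at which `F` is `≥ λ`
  have hSpos : volume S ≠ 0 := by
    intro h0
    have h1 : ENNReal.ofReal lam = 0 := le_antisymm (h0 ▸ hvol) bot_le
    exact absurd (ENNReal.ofReal_eq_zero.1 h1) (not_le.2 hlam)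
  have hSne : S.Nonempty := nonempty_of_measure_ne_zero hSpos
  have hSbdd : BddAbove S := ⟨2, fun z hz => (hS12 hz).2⟩
  have hSbdd' : BddBelow S := ⟨1, fun z hz => (hS12 hz).1⟩
  have hsMS : sSup S ∈ S := hS.csSup_mem hSne hSbdd
  have hFsM : lam ≤ F (sSup S) := by
    have hint : S ∩ Set.Iic (sSup S) = S := Set.inter_eq_left.2 fun z hz => le_csSup hSbdd hz
    simp only [hF, hint]
    exact (ENNReal.ofReal_le_iff_le_toReal hSfin).1 hvol
  -- the levels and the nodes
  set c : ℝ := lam / (D + 1) with hc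
  have hc0 : 0 < c := by positivity
  set y : ℕ → ℝ := fun i => ((i : ℝ) + 1 / 2) * c with hy
  have hy_pos : ∀ i, 0 < y i := fun i => by positivity
  have hy_mono : ∀ i j : ℕ, i ≤ j → y i ≤ y j := fun i j hij => by
    have : (i : ℝ) ≤ j := by exact_mod_cast hij
    simp only [hy]
    gcongr
  have hy_lt : ∀ i ≤ D, y i < lam := by
    intro i hi
    have hi' : (i : ℝ) ≤ D := by exact_mod_cast hi
    have h1 : ((i : ℝ) + 1 / 2) * c < ((D : ℝ) + 1) * c :=
      mul_lt_mul_of_pos_right (by linarith) hc0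
    have h2 : ((D : ℝ) + 1) * c = lam := by rw [hc]; field_simp
    simp only [hy]
    linarith
  set T : ℕ → Set ℝ := fun i => {z | z ∈ S ∧ y i ≤ F z} with hT
  have hT_closed : ∀ i, IsClosed (T i) := fun i =>
    hS.inter (isClosed_le continuous_const hF_cont)
  have hT_ne : ∀ i ≤ D, (T i).Nonempty := fun i hi => ⟨sSup S, hsMS, (hy_lt i hi).le.trans hFsM⟩
  have hT_bdd : ∀ i, BddBelow (T i) := fun i => hSbdd'.mono fun z hz => hz.1
  set x : ℕ → ℝ := fun i => sInf (T i) with hx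
  have hx_mem : ∀ i ≤ D, x i ∈ T i := fun i hi => (hT_closed i).csInf_mem (hT_ne i hi) (hT_bdd i)
  -- `F (x i) = y i`
  have hFx_le : ∀ i ≤ D, F (x i) ≤ y i := by
    intro i hi
    by_contra hcon
    rw [not_le] at hcon
    set U : Set ℝ := S ∩ Set.Iio (x i) with hU
    have hUfin : volume U ≠ ∞ := ne_top_of_le_ne_top hSfin (measure_mono Set.inter_subset_left)
    have hUvol : F (x i) ≤ (volume U).toReal := by
      have hsub : S ∩ Set.Iic (x i) ⊆ U ∪ {x i} := by
        intro z hz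
        rcases (show z ≤ x i from hz.2).lt_or_eq with hlt | heq
        · exact Or.inl ⟨hz.1, hlt⟩
        · exact Or.inr heq
      have h1 : volume (S ∩ Set.Iic (x i)) ≤ volume U :=
        calc volume (S ∩ Set.Iic (x i)) ≤ volume (U ∪ {x i}) := measure_mono hsub
          _ ≤ volume U + volume ({x i} : Set ℝ) := measure_union_le _ _
          _ = volume U := by rw [Real.volume_singleton, add_zero]
      exact ENNReal.toReal_mono hUfin h1
    have hUne : U.Nonempty := by
      refine nonempty_of_measure_ne_zero (μ := (volume : Measure ℝ)) fun h0 => ?_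
      have h1 : F (x i) ≤ 0 := by rw [h0, ENNReal.toReal_zero] at hUvol; exact hUvol
      linarith [hy_pos i]
    have hUbdd : BddAbove U := ⟨x i, fun z hz => hz.2.le⟩
    have hs'S : sSup U ∈ S :=
      (hS.closure_subset_iff.2 fun z hz => hz.1) (csSup_mem_closure hUne hUbdd)
    have hs'le : sSup U ≤ x i := csSup_le hUne fun z hz => hz.2.le
    rcases hs'le.lt_or_eq with hlt | heq
    · -- `sSup U < x i`: then `F (sSup U) ≥ vol U ≥ F (x i) > y i`, contradicting minimality
      have hUsub : U ⊆ S ∩ Set.Iic (sSup U) := fun z hz => ⟨hz.1, le_csSup hUbdd hz⟩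
      have hFs' : F (x i) ≤ F (sSup U) :=
        hUvol.trans (ENNReal.toReal_mono (hfin _) (measure_mono hUsub))
      have hmem : sSup U ∈ T i := ⟨hs'S, hcon.le.trans hFs'⟩
      exact absurd (csInf_le (hT_bdd i) hmem) (not_le.2 hlt)
    · -- `sSup U = x i`: points of `U` near `x i` already reach the level, by continuity of `F`
      obtain ⟨u, huU, hu⟩ := exists_lt_of_lt_csSup hUne
        (show x i - (F (x i) - y i) < sSup U by rw [heq]; linarith)
      have hFu : y i < F u := by
        have h1 := hF_sub u (x i) huU.2.le
        linarith
      have hmem : u ∈ T i := ⟨huU.1, hFu.le⟩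
      exact absurd (csInf_le (hT_bdd i) hmem) (not_le.2 huU.2)
  have hFx_eq : ∀ i ≤ D, F (x i) = y i := fun i hi => le_antisymm (hFx_le i hi) (hx_mem i hi).2
  refine ⟨x, fun i hi => (hx_mem i hi).1, fun i j hij hjD => ?_⟩
  have hiD : i ≤ D := hij.le.trans hjD
  have hTsub : T j ⊆ T i := fun z hz => ⟨hz.1, (hy_mono i j hij.le).trans hz.2⟩
  have hxij : x i ≤ x j := csInf_le_csInf (hT_bdd i) (hT_ne j hjD) hTsub
  calc ((j : ℝ) - i) * (lam / (D + 1)) = y j - y i := by simp only [hy, hc]; ring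
    _ = F (x j) - F (x i) := by rw [hFx_eq i hiD, hFx_eq j hjD]
    _ ≤ x j - x i := hF_sub _ _ hxij

/-- `∏_{j ≤ D, j ≠ i} |i - j| = i! (D - i)!`. [folklore] -/
theorem prod_abs_sub_eq_factorial {D i : ℕ} (hi : i ≤ D) :
    ∏ j ∈ (Finset.range (D + 1)).erase i, |(i : ℝ) - j| = ((i ! * (D - i)! : ℕ) : ℝ) := by
  classical
  set f : ℕ → ℝ := fun j => if j = i then 1 else |(i : ℝ) - j| with hf
  have h1 : ∏ j ∈ (Finset.range (D + 1)).erase i, |(i : ℝ) - j| =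
      ∏ j ∈ (Finset.range (D + 1)).erase i, f j := by
    refine Finset.prod_congr rfl fun j hj => ?_
    simp only [hf]
    rw [if_neg (Finset.ne_of_mem_erase hj)]
  have hfi : f i = 1 := by simp [hf]
  rw [h1, Finset.prod_erase _ hfi, ← Finset.prod_range_mul_prod_Ico f (Nat.le_succ_of_le hi),
    Finset.prod_eq_prod_Ico_succ_bot (Nat.lt_succ_of_le hi), hfi, one_mul]
  have hleft : ∏ j ∈ Finset.range i, f j = (i ! : ℝ) := by
    calc ∏ j ∈ Finset.range i, f j = ∏ j ∈ Finset.range i, (((i - 1 - j : ℕ) : ℝ) + 1) := by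
          refine Finset.prod_congr rfl fun j hj => ?_
          have hji : j < i := Finset.mem_range.1 hj
          have hcast : ((i - 1 - j : ℕ) : ℝ) + 1 = (i : ℝ) - j := by
            rw [← Nat.cast_sub hji.le, ← Nat.cast_succ]
            congr 1
            omega
          simp only [hf]
          rw [if_neg hji.ne, hcast, abs_of_pos (sub_pos.2 (by exact_mod_cast hji))]
      _ = ∏ j ∈ Finset.range i, ((j : ℝ) + 1) :=
          Finset.prod_range_reflect (fun j => (j : ℝ) + 1) i
      _ = (i ! : ℝ) := by
          rw [← Finset.prod_range_add_one_eq_factorial]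
          push_cast
          rfl
  have hright : ∏ j ∈ Finset.Ico (i + 1) (D + 1), f j = ((D - i)! : ℝ) := by
    rw [Finset.prod_Ico_eq_prod_range, show D + 1 - (i + 1) = D - i by omega]
    calc ∏ k ∈ Finset.range (D - i), f (i + 1 + k)
        = ∏ k ∈ Finset.range (D - i), ((k : ℝ) + 1) := by
          refine Finset.prod_congr rfl fun k _ => ?_
          have hne : i + 1 + k ≠ i := by omega
          simp only [hf]
          rw [if_neg hne]
          push_cast
          rw [show (i : ℝ) - (i + 1 + k) = -((k : ℝ) + 1) by ring, abs_neg,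
            abs_of_pos (by positivity)]
      _ = ((D - i)! : ℝ) := by
          rw [← Finset.prod_range_add_one_eq_factorial]
          push_cast
          rfl
  rw [hleft, hright]
  push_cast
  ring

/-- `Σ_{i ≤ D} 1/(i! (D-i)!) = 2^D / D!`. [folklore] -/
theorem sum_inv_factorial_mul_factorial (D : ℕ) :
    ∑ i ∈ Finset.range (D + 1), (1 / ((i ! * (D - i)! : ℕ) : ℝ)) = (2 : ℝ) ^ D / D ! := by
  have h : ∀ i ∈ Finset.range (D + 1),
      (1 / ((i ! * (D - i)! : ℕ) : ℝ)) = (D.choose i : ℝ) / D ! := by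
    intro i hi
    have hiD : i ≤ D := Nat.lt_succ_iff.1 (Finset.mem_range.1 hi)
    have hkey : (D.choose i : ℝ) * ((i ! * (D - i)! : ℕ) : ℝ) = D ! := by
      have := Nat.choose_mul_factorial_mul_factorial hiD
      rw [← Nat.cast_mul, ← mul_assoc]
      exact_mod_cast this
    have hpos : (0 : ℝ) < ((i ! * (D - i)! : ℕ) : ℝ) := by positivity
    have hDpos : (0 : ℝ) < D ! := by positivity
    field_simp
    linarith [hkey]
  rw [Finset.sum_congr rfl h, ← Finset.sum_div]
  congr 1
  have := Nat.sum_range_choose D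
  exact_mod_cast this

/-- The coefficient-`ℓ¹`-norm of a Lagrange basis divisor over `ℝ`:
`‖C (a-b)⁻¹ (X - C b)‖₁ ≤ |a - b|⁻¹ (1 + |b|)`. [folklore] -/
theorem pwnorm_basisDivisor_real_le (a b : ℝ) :
    pwnorm (normRingSeminorm ℝ) (Lagrange.basisDivisor a b) ≤ |a - b|⁻¹ * (1 + |b|) := by
  unfold Lagrange.basisDivisor
  refine (pwnorm_mul_le _ _ _).trans ?_
  rw [pwnorm_C]
  refine mul_le_mul (le_of_eq ?_) ((pwnorm_X_sub_C_le _ b).trans (le_of_eq ?_))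
    (pwnorm_nonneg _ _) (by positivity)
  · change ‖(a - b)⁻¹‖ = |a - b|⁻¹
    rw [norm_inv, Real.norm_eq_abs]
  · change ‖(1 : ℝ)‖ + ‖b‖ = 1 + |b|
    rw [norm_one, Real.norm_eq_abs]

/-- **Coefficients from values at separated nodes** (Lagrange interpolation). If
`x₀, …, x_D ∈ [-2, 2]` satisfy `x_j - x_i ≥ (j - i) δ` for `i < j` (`δ > 0`) and a real
polynomial `p` of degree `≤ D` satisfies `|p(x_i)| ≤ ε` for all `i`, then every coefficient of
`p` is at most `(6/δ)^D / D! · ε` in absolute value: `p = Σ p(x_i) ℓ_i`, the coefficient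
`ℓ¹`-norm of `ℓ_i = ∏_{j ≠ i} (X - x_j)/(x_i - x_j)` is `≤ ∏_{j ≠ i} 3/|x_i - x_j|
≤ 3^D/(δ^D i! (D-i)!)`, and `Σ_i 1/(i!(D-i)!) = 2^D/D!`. [folklore] -/
theorem abs_coeff_le_of_nodes {D : ℕ} {x : ℕ → ℝ} (hx2 : ∀ i ≤ D, |x i| ≤ 2) {δ : ℝ}
    (hδ : 0 < δ) (hsep : ∀ i j : ℕ, i < j → j ≤ D → ((j : ℝ) - i) * δ ≤ x j - x i)
    {p : ℝ[X]} (hp : p.degree < (D + 1 : ℕ)) {ε : ℝ} (hε : ∀ i ≤ D, |p.eval (x i)| ≤ ε)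
    (q : ℕ) : |p.coeff q| ≤ (6 / δ) ^ D / D ! * ε := by
  classical
  set s : Finset ℕ := Finset.range (D + 1) with hs
  have hmem : ∀ {i}, i ∈ s → i ≤ D := fun hi => Nat.lt_succ_iff.1 (Finset.mem_range.1 hi)
  -- the gaps `|x i - x j| ≥ |i - j| δ`
  have hgap : ∀ i ≤ D, ∀ j ≤ D, |(i : ℝ) - j| * δ ≤ |x i - x j| := by
    intro i hi j hj
    rcases lt_trichotomy i j with hij | rfl | hji
    · have h1 := hsep i j hij hj
      have h2 : (i : ℝ) < j := by exact_mod_cast hij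
      rw [abs_sub_comm, abs_of_pos (sub_pos.2 h2), abs_sub_comm]
      exact h1.trans (le_abs_self _)
    · simp
    · have h1 := hsep j i hji hi
      have h2 : (j : ℝ) < i := by exact_mod_cast hji
      rw [abs_of_pos (sub_pos.2 h2)]
      exact h1.trans (le_abs_self _)
  have hinj : Set.InjOn x s := by
    intro i hi j hj hxij
    by_contra hne
    have h1 := hgap i (hmem hi) j (hmem hj)
    rw [hxij, sub_self, abs_zero] at h1
    have h2 : 0 < |(i : ℝ) - j| * δ :=
      mul_pos (abs_pos.2 (sub_ne_zero.2 (by exact_mod_cast hne))) hδ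
    linarith
  have hcard : p.degree < s.card := by rwa [hs, Finset.card_range]
  have hinterp := Lagrange.eq_interpolate (v := x) hinj hcard
  have hcoeff : p.coeff q = ∑ i ∈ s, p.eval (x i) * (Lagrange.basis s x i).coeff q := by
    conv_lhs => rw [hinterp]
    rw [Lagrange.interpolate_apply, Polynomial.finsetSum_coeff]
    exact Finset.sum_congr rfl fun i _ => Polynomial.coeff_C_mul _
  have hε0 : 0 ≤ ε := (abs_nonneg _).trans (hε 0 (Nat.zero_le _))
  -- the `ℓ¹` bound for the basis polynomials
  have hbasis : ∀ i ∈ s, |(Lagrange.basis s x i).coeff q| ≤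
      (3 : ℝ) ^ D / (δ ^ D * ((i ! * (D - i)! : ℕ) : ℝ)) := by
    intro i hi
    have hiD : i ≤ D := hmem hi
    calc |(Lagrange.basis s x i).coeff q|
        = normRingSeminorm ℝ ((Lagrange.basis s x i).coeff q) := (Real.norm_eq_abs _).symm
      _ ≤ pwnorm (normRingSeminorm ℝ) (Lagrange.basis s x i) := le_pwnorm _ _ _
      _ ≤ ∏ j ∈ s.erase i, pwnorm (normRingSeminorm ℝ) (Lagrange.basisDivisor (x i) (x j)) := by
          unfold Lagrange.basis
          exact pwnorm_prod_le _ (by change ‖(1 : ℝ)‖ ≤ 1; rw [norm_one]) _ _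
      _ ≤ ∏ j ∈ s.erase i, (3 / (|(i : ℝ) - j| * δ)) := by
          refine Finset.prod_le_prod (fun j _ => pwnorm_nonneg _ _) fun j hj => ?_
          have hjD : j ≤ D := hmem (Finset.mem_of_mem_erase hj)
          have hne : j ≠ i := Finset.ne_of_mem_erase hj
          have hpos : 0 < |(i : ℝ) - j| * δ :=
            mul_pos (abs_pos.2 (sub_ne_zero.2 (by exact_mod_cast hne.symm))) hδ
          refine (pwnorm_basisDivisor_real_le _ _).trans ?_
          rw [div_eq_inv_mul]
          refine mul_le_mul (inv_anti₀ hpos (hgap i hiD j hjD)) ?_ (by positivity)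
            (by positivity)
          linarith [hx2 j hjD]
      _ = (3 : ℝ) ^ D / (δ ^ D * ((i ! * (D - i)! : ℕ) : ℝ)) := by
          rw [Finset.prod_div_distrib, Finset.prod_const, Finset.card_erase_of_mem hi, hs,
            Finset.card_range, Nat.add_sub_cancel, Finset.prod_mul_distrib, Finset.prod_const,
            Finset.card_erase_of_mem hi, Finset.card_range, Nat.add_sub_cancel,
            prod_abs_sub_eq_factorial hiD]
          ring
  calc |p.coeff q| = |∑ i ∈ s, p.eval (x i) * (Lagrange.basis s x i).coeff q| := by rw [hcoeff]
    _ ≤ ∑ i ∈ s, |p.eval (x i) * (Lagrange.basis s x i).coeff q| :=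
        Finset.abs_sum_le_sum_abs _ _
    _ ≤ ∑ i ∈ s, ε * ((3 : ℝ) ^ D / (δ ^ D * ((i ! * (D - i)! : ℕ) : ℝ))) := by
        refine Finset.sum_le_sum fun i hi => ?_
        rw [abs_mul]
        exact mul_le_mul (hε i (hmem hi)) (hbasis i hi) (abs_nonneg _) hε0
    _ = ε * (3 / δ) ^ D * ∑ i ∈ Finset.range (D + 1), (1 / ((i ! * (D - i)! : ℕ) : ℝ)) := by
        rw [Finset.mul_sum]
        refine Finset.sum_congr rfl fun i _ => ?_
        rw [div_pow]
        ring
    _ = ε * (3 / δ) ^ D * ((2 : ℝ) ^ D / D !) := by rw [sum_inv_factorial_mul_factorial D]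
    _ = (6 / δ) ^ D / D ! * ε := by
        rw [show (6 : ℝ) / δ = 2 * (3 / δ) by ring, mul_pow]
        ring

/-- `(D+1)^D / D! ≤ 3^(D+1)` (from `(D+1)^{D+1}/(D+1)! ≤ e^{D+1}` and `e < 3`). [folklore] -/
theorem succ_pow_div_factorial_le (D : ℕ) : ((D : ℝ) + 1) ^ D / D ! ≤ (3 : ℝ) ^ (D + 1) := by
  have h1 : ((D : ℝ) + 1) ^ D / D ! = ((D : ℝ) + 1) ^ (D + 1) / (D + 1)! := by
    rw [Nat.factorial_succ, pow_succ]
    push_cast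
    have hD : (0 : ℝ) < D ! := by positivity
    field_simp
  have h2 : ((D : ℝ) + 1) ^ (D + 1) / (D + 1)! ≤ Real.exp ((D : ℝ) + 1) := by
    have := Real.pow_div_factorial_le_exp ((D : ℝ) + 1) (by positivity) (D + 1)
    exact_mod_cast this
  have h3 : Real.exp ((D : ℝ) + 1) ≤ (3 : ℝ) ^ (D + 1) := by
    have he : Real.exp 1 ≤ 3 := by
      have := Real.exp_one_lt_d9
      linarith
    calc Real.exp ((D : ℝ) + 1) = Real.exp 1 ^ (D + 1) := by
          rw [← Real.exp_nat_mul]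
          push_cast
          ring_nf
      _ ≤ (3 : ℝ) ^ (D + 1) := pow_le_pow_left₀ (Real.exp_pos 1).le he _
  linarith [h1.le, h2, h3]

/-- **A Turán–Remez-type inequality.** If a real polynomial `p` of degree `≤ D` satisfies
`|p(A)| ≤ ε` on a subset of `[1, 2]` of Lebesgue measure `≥ 1/4`, then every coefficient of `p`
is at most `3 · 72^D · ε` in absolute value (separated nodes in the closed sublevel set,
`exists_separated_nodes`, and Lagrange interpolation, `abs_coeff_le_of_nodes`, with
`(24(D+1))^D/D! ≤ 3 · 72^D`). In particular, a polynomial with one coefficient `> 3 · 72^D ε`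
is `≤ ε` only on a set of amplitudes of measure `< 1/4`. [folklore] -/
theorem abs_coeff_le_of_volume_sublevel {D : ℕ} {p : ℝ[X]} (hp : p.degree < (D + 1 : ℕ))
    {ε : ℝ} (hvol : ENNReal.ofReal (1 / 4) ≤
      volume (Set.Icc (1 : ℝ) 2 ∩ {A : ℝ | |p.eval A| ≤ ε})) (q : ℕ) :
    |p.coeff q| ≤ 3 * (72 : ℝ) ^ D * ε := by
  set S : Set ℝ := Set.Icc (1 : ℝ) 2 ∩ {A : ℝ | |p.eval A| ≤ ε} with hSdef
  have hS : IsClosed S :=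
    isClosed_Icc.inter (isClosed_le (continuous_abs.comp (Polynomial.continuous p))
      continuous_const)
  obtain ⟨x, hxS, hsep⟩ :=
    exists_separated_nodes hS Set.inter_subset_left (by norm_num : (0 : ℝ) < 1 / 4) hvol D
  have hx2 : ∀ i ≤ D, |x i| ≤ 2 := fun i hi => by
    have h := (hxS i hi).1
    rw [abs_of_nonneg (by linarith [h.1])]
    exact h.2
  have hεi : ∀ i ≤ D, |p.eval (x i)| ≤ ε := fun i hi => (hxS i hi).2
  have hε0 : 0 ≤ ε := (abs_nonneg _).trans (hεi 0 (Nat.zero_le _))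
  have hδ : (0 : ℝ) < 1 / 4 / (D + 1) := by positivity
  have h := abs_coeff_le_of_nodes hx2 hδ hsep hp hεi q
  refine h.trans (mul_le_mul_of_nonneg_right ?_ hε0)
  have hD : (0 : ℝ) < D ! := by positivity
  calc (6 / (1 / 4 / ((D : ℝ) + 1))) ^ D / D ! = (24 : ℝ) ^ D * (((D : ℝ) + 1) ^ D / D !) := by
        rw [show (6 : ℝ) / (1 / 4 / ((D : ℝ) + 1)) = 24 * ((D : ℝ) + 1) by field_simp; ring,
          mul_pow]
        ring
    _ ≤ (24 : ℝ) ^ D * (3 : ℝ) ^ (D + 1) := by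
        gcongr
        exact succ_pow_div_factorial_le D
    _ = 3 * (72 : ℝ) ^ D := by rw [pow_succ, show (72 : ℝ) = 24 * 3 by norm_num, mul_pow]; ring

/-! ### Measure-theoretic and combinatorial helpers -/

/-- **Small amplitudes are rare where one mode is large** (the Turán–Remez lemma applied to the
polynomial `A ↦ ⟨mode v₀ n t k, Σ_{q<N} A^q mode v₀ q t k⟩`, whose `n`-th coefficient is
`‖mode v₀ n t k‖²`): if `3 · 72^{N-1} e^{-μ k₃} ε < ‖mode v₀ n t k‖` (`n < N`), the amplitudes
`A ∈ [1, 2]` with `‖Σ_{q<N} A^q mode v₀ q t k‖ ≤ e^{-μ k₃} ε` form a set of measure `< 1/4`.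
[folklore] -/
theorem volume_smallAmplitude_lt {v₀ : EuclideanSpace ℝ (Fin 3) → EuclideanSpace ℝ (Fin 3)}
    {t : ℝ} {n N : ℕ} (hnN : n < N) {k : EuclideanSpace ℝ (Fin 3)} {μ ε : ℝ} (hε : 0 ≤ ε)
    (hbig : 3 * (72 : ℝ) ^ (N - 1) * (Real.exp (-(μ * k 2)) * ε) < ‖mode v₀ n t k‖) :
    volume (Set.Icc (1 : ℝ) 2 ∩ {A : ℝ |
      ‖∑ q ∈ Finset.range N, A ^ q • mode v₀ q t k‖ ≤ Real.exp (-(μ * k 2)) * ε}) <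
      ENNReal.ofReal (1 / 4) := by
  classical
  by_contra hge
  rw [not_lt] at hge
  set m : ℕ → EuclideanSpace ℝ (Fin 3) := fun q => mode v₀ q t k with hm
  set η : ℝ := Real.exp (-(μ * k 2)) * ε with hη
  have hη0 : 0 ≤ η := by positivity
  have hmpos : 0 < ‖m n‖ := lt_of_le_of_lt (by positivity) hbig
  -- the polynomial `A ↦ ⟨m n, Σ A^q m q⟩`
  set P : ℝ[X] := ∑ q ∈ Finset.range N, C ⟪m n, m q⟫ * X ^ q with hP
  have hPeval : ∀ A : ℝ, P.eval A = ⟪m n, ∑ q ∈ Finset.range N, A ^ q • m q⟫ := by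
    intro A
    rw [hP, eval_finsetSum, inner_sum]
    refine Finset.sum_congr rfl fun q _ => ?_
    rw [eval_mul, eval_C, eval_pow, eval_X, real_inner_smul_right, mul_comm]
  have hPdeg : P.degree < (N - 1 + 1 : ℕ) := by
    rw [Nat.sub_add_cancel (Nat.one_le_of_lt hnN), hP]
    refine lt_of_le_of_lt (Polynomial.degree_sum_le _ _)
      ((Finset.sup_lt_iff (WithBot.bot_lt_coe N)).2 fun q hq => ?_)
    exact lt_of_le_of_lt (degree_C_mul_X_pow_le q _)
      (WithBot.coe_lt_coe.2 (Finset.mem_range.1 hq))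
  have hPcoeff : P.coeff n = ‖m n‖ ^ 2 := by
    rw [hP, finsetSum_coeff]
    simp only [coeff_C_mul_X_pow]
    rw [Finset.sum_ite_eq, if_pos (Finset.mem_range.2 hnN), real_inner_self_eq_norm_sq]
  -- the sublevel set of `P` at level `‖m n‖ η` contains the small-amplitude set
  have hsub : Set.Icc (1 : ℝ) 2 ∩ {A : ℝ | ‖∑ q ∈ Finset.range N, A ^ q • m q‖ ≤ η} ⊆
      Set.Icc (1 : ℝ) 2 ∩ {A : ℝ | |P.eval A| ≤ ‖m n‖ * η} := by
    rintro A ⟨hA, hsmall⟩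
    refine ⟨hA, ?_⟩
    show |P.eval A| ≤ ‖m n‖ * η
    rw [hPeval]
    exact (abs_real_inner_le_norm _ _).trans (mul_le_mul_of_nonneg_left hsmall (norm_nonneg _))
  have hvol : ENNReal.ofReal (1 / 4) ≤
      volume (Set.Icc (1 : ℝ) 2 ∩ {A : ℝ | |P.eval A| ≤ ‖m n‖ * η}) :=
    hge.trans (measure_mono hsub)
  have hc := abs_coeff_le_of_volume_sublevel hPdeg hvol n
  rw [hPcoeff, abs_of_nonneg (sq_nonneg _)] at hc
  -- `‖m n‖² ≤ 3·72^{N-1} ‖m n‖ η` forces `‖m n‖ ≤ 3·72^{N-1} η < ‖m n‖`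
  have h1 : ‖m n‖ ≤ 3 * (72 : ℝ) ^ (N - 1) * η := by
    have h2 : ‖m n‖ * ‖m n‖ ≤ (3 * (72 : ℝ) ^ (N - 1) * η) * ‖m n‖ := by nlinarith [hc]
    exact le_of_mul_le_mul_right h2 hmpos
  exact absurd (h1.trans_lt hbig) (lt_irrefl _)

/-- **Good amplitudes are frequent** (Fubini and Markov). Let `G` have finite positive measure
and let `Z ⊆ ℝ × G` be measurable with `k`-sections of measure `≤ 1/4` for `k ∈ G`. Then the
amplitudes `A ∈ [1, 2]` whose `A`-section of `Z` has measure `< vol(G)/2` form a set of measure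
`≥ 1/2`: `∫ vol(Z_A) dA = ∫_G vol(Z^k) dk ≤ vol(G)/4`, and Markov's inequality. [folklore] -/
theorem half_le_volume_goodAmplitudes {G : Set (EuclideanSpace ℝ (Fin 3))} (hG : MeasurableSet G)
    (hG0 : volume G ≠ 0) (hGtop : volume G ≠ ∞) {Z : Set (ℝ × EuclideanSpace ℝ (Fin 3))}
    (hZ : MeasurableSet Z) (hZG : ∀ x ∈ Z, x.2 ∈ G)
    (hsec : ∀ k ∈ G, volume ((fun A : ℝ => (A, k)) ⁻¹' Z) ≤ 4⁻¹) :
    2⁻¹ ≤ volume (Set.Icc (1 : ℝ) 2 ∩ {A : ℝ | volume (Prod.mk A ⁻¹' Z) < volume G / 2}) := by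
  set f : ℝ → ℝ≥0∞ := fun A => volume (Prod.mk A ⁻¹' Z) with hf
  have hf_meas : Measurable f := measurable_measure_prodMk_left hZ
  -- `∫ f = (vol × vol)(Z) = ∫_k vol(Z^k) ≤ vol(G)/4`
  have hint : ∫⁻ A, f A ≤ 4⁻¹ * volume G := by
    have h1 : ∫⁻ A, f A = (volume : Measure ℝ).prod (volume : Measure (EuclideanSpace ℝ (Fin 3))) Z :=
      (Measure.prod_apply hZ).symm
    rw [h1, Measure.prod_apply_symm hZ, ← lintegral_indicator_const hG]
    refine lintegral_mono fun k => ?_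
    by_cases hk : k ∈ G
    · rw [Set.indicator_of_mem hk]
      exact hsec k hk
    · rw [Set.indicator_of_notMem hk]
      have hempty : (fun A : ℝ => (A, k)) ⁻¹' Z = ∅ := by
        ext A
        simp only [Set.mem_preimage, Set.mem_empty_iff_false, iff_false]
        exact fun hA => hk (hZG _ hA)
      rw [hempty, measure_empty]
  -- Markov
  have hhalf0 : volume G / 2 ≠ 0 := (ENNReal.div_pos_iff.2 ⟨hG0, ENNReal.ofNat_ne_top⟩).ne'
  have hhalftop : volume G / 2 ≠ ∞ := ENNReal.div_ne_top hGtop two_ne_zero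
  have hmarkov : volume {A : ℝ | volume G / 2 ≤ f A} ≤ 2⁻¹ := by
    have h1 : volume G / 2 * volume {A : ℝ | volume G / 2 ≤ f A} ≤ 4⁻¹ * volume G :=
      (mul_meas_ge_le_lintegral₀ hf_meas.aemeasurable _).trans hint
    by_contra hcon
    rw [not_le] at hcon
    have h2 : volume G / 2 * 2⁻¹ < volume G / 2 * volume {A : ℝ | volume G / 2 ≤ f A} :=
      ENNReal.mul_lt_mul_right hhalf0 hhalftop hcon
    have h3 : volume G / 2 * 2⁻¹ = 4⁻¹ * volume G := by
      rw [div_eq_mul_inv, mul_assoc, ← ENNReal.mul_inv (Or.inl two_ne_zero)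
        (Or.inl ENNReal.ofNat_ne_top), mul_comm]
      norm_num
    rw [h3] at h2
    exact absurd (h2.trans_le h1) (lt_irrefl _)
  -- complement inside `[1, 2]`
  have hcover : Set.Icc (1 : ℝ) 2 ⊆
      (Set.Icc (1 : ℝ) 2 ∩ {A : ℝ | f A < volume G / 2}) ∪ {A : ℝ | volume G / 2 ≤ f A} := by
    intro A hA
    by_cases h : f A < volume G / 2
    · exact Or.inl ⟨hA, h⟩
    · exact Or.inr (not_lt.1 h)
  have h1 : (1 : ℝ≥0∞) ≤ volume (Set.Icc (1 : ℝ) 2 ∩ {A : ℝ | f A < volume G / 2}) + 2⁻¹ := by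
    calc (1 : ℝ≥0∞) = volume (Set.Icc (1 : ℝ) 2) := by rw [Real.volume_Icc]; norm_num
      _ ≤ volume (Set.Icc (1 : ℝ) 2 ∩ {A : ℝ | f A < volume G / 2}) +
            volume {A : ℝ | volume G / 2 ≤ f A} :=
          (measure_mono hcover).trans (measure_union_le _ _)
      _ ≤ _ := add_le_add le_rfl hmarkov
  rw [← ENNReal.inv_two_add_inv_two] at h1
  exact (ENNReal.add_le_add_iff_right (by norm_num)).1 h1

/-- **Energy on `G` from a good amplitude.** If `vol G ≥ s`, `ε² s ≥ 2` (`ε ≥ 0`), the weight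
`w` is positive and the set of `k ∈ G` with `‖W k‖ ≤ w(k)⁻¹ ε` has measure `< vol(G)/2`, then
`∫_G ‖w(k) W(k)‖² dk ≥ 1` (the complement in `G` has measure `≥ vol(G)/2 ≥ s/2` and the
integrand is `> ε²` there). [folklore] -/
theorem one_le_setLIntegral_weighted {G : Set (EuclideanSpace ℝ (Fin 3))} (hG : MeasurableSet G)
    {s : ℝ} (hsG : ENNReal.ofReal s ≤ volume G)
    {W : EuclideanSpace ℝ (Fin 3) → EuclideanSpace ℝ (Fin 3)} (hW : Measurable W)
    {w : EuclideanSpace ℝ (Fin 3) → ℝ} (hw : Measurable w) (hwpos : ∀ k, 0 < w k)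
    {ε : ℝ} (hε0 : 0 ≤ ε) (hεs : 2 ≤ ε ^ 2 * s)
    (hsmall : volume (G ∩ {k | ‖W k‖ ≤ (w k)⁻¹ * ε}) < volume G / 2) :
    1 ≤ ∫⁻ k in G, ‖w k • W k‖ₑ ^ 2 := by
  set L : Set (EuclideanSpace ℝ (Fin 3)) := G ∩ {k | (w k)⁻¹ * ε < ‖W k‖} with hL
  have hL_meas : MeasurableSet L :=
    hG.inter (measurableSet_lt ((hw.inv).mul measurable_const) hW.norm)
  have hLG : L ⊆ G := Set.inter_subset_left
  -- `vol L ≥ vol G / 2`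
  have hLvol : volume G / 2 ≤ volume L := by
    have hcover : G ⊆ (G ∩ {k | ‖W k‖ ≤ (w k)⁻¹ * ε}) ∪ L := by
      intro k hk
      by_cases h : ‖W k‖ ≤ (w k)⁻¹ * ε
      · exact Or.inl ⟨hk, h⟩
      · exact Or.inr ⟨hk, not_le.1 h⟩
    by_contra hcon
    rw [not_le] at hcon
    have h1 : volume G < volume G / 2 + volume G / 2 :=
      calc volume G ≤ volume (G ∩ {k | ‖W k‖ ≤ (w k)⁻¹ * ε}) + volume L :=
            (measure_mono hcover).trans (measure_union_le _ _)
        _ < volume G / 2 + volume G / 2 := ENNReal.add_lt_add hsmall hcon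
    rw [ENNReal.add_halves] at h1
    exact lt_irrefl _ h1
  -- the integrand is `≥ ε²` on `L`
  have hpt : ∀ k ∈ L, ENNReal.ofReal (ε ^ 2) ≤ ‖w k • W k‖ₑ ^ 2 := by
    intro k hk
    have h1 : ε < ‖w k • W k‖ := by
      rw [norm_smul, Real.norm_eq_abs, abs_of_pos (hwpos k)]
      have h2 : (w k)⁻¹ * ε < ‖W k‖ := hk.2
      rwa [inv_mul_lt_iff₀ (hwpos k)] at h2
    rw [← ofReal_norm, ← ENNReal.ofReal_pow (norm_nonneg _)]
    exact ENNReal.ofReal_le_ofReal (pow_le_pow_left₀ hε0 h1.le 2)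
  have hs2 : (1 : ℝ≥0∞) ≤ ENNReal.ofReal (ε ^ 2) * (ENNReal.ofReal s / 2) := by
    rw [← mul_div_assoc, ← ENNReal.ofReal_mul (sq_nonneg ε),
      ENNReal.le_div_iff_mul_le (Or.inl two_ne_zero) (Or.inl ENNReal.ofNat_ne_top), one_mul,
      ← ENNReal.ofReal_ofNat 2]
    exact ENNReal.ofReal_le_ofReal (by exact_mod_cast hεs)
  calc (1 : ℝ≥0∞) ≤ ENNReal.ofReal (ε ^ 2) * (ENNReal.ofReal s / 2) := hs2
    _ ≤ ENNReal.ofReal (ε ^ 2) * volume L := by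
        gcongr
        exact (ENNReal.div_le_div_right hsG 2).trans hLvol
    _ = ∫⁻ k in L, ENNReal.ofReal (ε ^ 2) := by rw [setLIntegral_const]
    _ ≤ ∫⁻ k in L, ‖w k • W k‖ₑ ^ 2 := setLIntegral_mono' hL_meas hpt
    _ ≤ ∫⁻ k in G, ‖w k • W k‖ₑ ^ 2 := lintegral_mono_set hLG

/-- A recursively thinned subsequence of a frequently-true predicate: `P (n_j)` for all `j`,
`n₀ ≤ n_0` and `next n_j ≤ n_{j+1}`. [folklore] -/
theorem exists_seq_of_frequently {P : ℕ → Prop} (hP : ∃ᶠ n in atTop, P n) (next : ℕ → ℕ)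
    (n₀ : ℕ) : ∃ idx : ℕ → ℕ, (∀ j, P (idx j)) ∧ n₀ ≤ idx 0 ∧ ∀ j, next (idx j) ≤ idx (j + 1) := by
  choose g hg hgP using hP.forall_exists_of_atTop
  refine ⟨fun j => Nat.rec (g n₀) (fun _ prev => g (next prev)) j, fun j => ?_, hg n₀,
    fun j => hg _⟩
  induction j with
  | zero => exact hgP _
  | succ j _ => exact hgP _

/-- A point lying in infinitely many of a sequence of subsets of `[1, 2]` of measure `≥ 1/2`
(the limsup of the sequence has measure `≥ 1/2`, by continuity from above). [folklore] -/
theorem exists_mem_frequently {B : ℕ → Set ℝ} (hBm : ∀ j, MeasurableSet (B j))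
    (hBsub : ∀ j, B j ⊆ Set.Icc (1 : ℝ) 2) (hBvol : ∀ j, 2⁻¹ ≤ volume (B j)) :
    ∃ A : ℝ, ∀ M : ℕ, ∃ j, M ≤ j ∧ A ∈ B j := by
  set U : ℕ → Set ℝ := fun M => ⋃ j, ⋃ (_ : M ≤ j), B j with hU
  have hU_anti : Antitone U := by
    intro M M' hMM' z hz
    simp only [hU, Set.mem_iUnion] at hz ⊢
    obtain ⟨j, hj, hz⟩ := hz
    exact ⟨j, hMM'.trans hj, hz⟩
  have hU_meas : ∀ M, MeasurableSet (U M) := fun M =>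
    MeasurableSet.iUnion fun j => MeasurableSet.iUnion fun _ => hBm j
  have hU_sub : U 0 ⊆ Set.Icc (1 : ℝ) 2 :=
    Set.iUnion_subset fun j => Set.iUnion_subset fun _ => hBsub j
  have hU_fin : volume (U 0) ≠ ∞ := by
    refine ne_top_of_le_ne_top ?_ (measure_mono hU_sub)
    rw [Real.volume_Icc]
    exact ENNReal.ofReal_ne_top
  have hU_vol : ∀ M, 2⁻¹ ≤ volume (U M) := fun M =>
    (hBvol M).trans (measure_mono fun z hz => Set.mem_iUnion₂.2 ⟨M, le_rfl, hz⟩)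
  have hinter : 2⁻¹ ≤ volume (⋂ M, U M) := by
    rw [hU_anti.measure_iInter (fun M => (hU_meas M).nullMeasurableSet) ⟨0, hU_fin⟩]
    exact le_iInf hU_vol
  have hne : (⋂ M, U M).Nonempty := by
    refine nonempty_of_measure_ne_zero (μ := (volume : Measure ℝ)) fun h0 => ?_
    rw [h0] at hinter
    exact absurd hinter (by norm_num)
  obtain ⟨A, hA⟩ := hne
  refine ⟨A, fun M => ?_⟩
  have h1 := Set.mem_iInter.1 hA M
  simp only [hU] at h1
  obtain ⟨j, hj, hAj⟩ := Set.mem_iUnion₂.1 h1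
  exact ⟨j, hj, hAj⟩

/-- An integral is infinite if it is `≥ 1` on each of infinitely many pairwise disjoint
measurable sets. [folklore] -/
theorem lintegral_eq_top_of_disjoint {f : EuclideanSpace ℝ (Fin 3) → ℝ≥0∞}
    {Gs : ℕ → Set (EuclideanSpace ℝ (Fin 3))} (hGm : ∀ j, MeasurableSet (Gs j))
    (hdisj : Pairwise (Function.onFun Disjoint Gs)) {J : Set ℕ} (hJ : J.Infinite)
    (hunit : ∀ j ∈ J, 1 ≤ ∫⁻ k in Gs j, f k) : ∫⁻ k, f k = ∞ := by
  by_contra hne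
  obtain ⟨M, hM⟩ := ENNReal.exists_nat_gt hne
  obtain ⟨F, hFJ, hFcard⟩ := hJ.exists_subset_card_eq M
  have h1 : (M : ℝ≥0∞) ≤ ∫⁻ k, f k :=
    calc (M : ℝ≥0∞) = ∑ j ∈ F, (1 : ℝ≥0∞) := by simp [hFcard]
      _ ≤ ∑ j ∈ F, ∫⁻ k in Gs j, f k := Finset.sum_le_sum fun j hj => hunit j (hFJ hj)
      _ = ∫⁻ k in ⋃ j ∈ F, Gs j, f k :=
          (lintegral_biUnion_finset (hdisj.set_pairwise _) (fun j _ => hGm j) f).symm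
      _ ≤ ∫⁻ k, f k := setLIntegral_le_lintegral _ _
  exact absurd hM (not_lt.2 h1)

end LiSinai

open LiSinai

/-! ### The single-mode criterion -/

/-- **Single-mode criterion for the core fact** (a sign-free form of the first inference of
§10 of the source, "`A^p g_p(k,t)` … takes values `O(p)`. This immediately implies that at `t`
the energy is infinite"). If ONE admissible datum `v₀` (measurable, bounded, vanishing off
`{a ≤ k₃, |k| ≤ R}` with `a > 0`, incompressible) has, at one time `t > 0` and for some
`ρ, σ > 0`, single modes with `vol {k : ρⁿ ≤ ‖mode v₀ n t k‖} ≥ σⁿ` for infinitely many `n`,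
then `LiSinaiSeriesEnergyInfinite` holds: for a suitable tilt `μ ≥ 0` and amplitude
`A ∈ [1, 2]` the admissible datum `A v₀` has infinite `e^{2μk₃}`-weighted energy at `t`
(Turán–Remez lemma in the amplitude at each `k`, Fubini–Markov, a limsup of good amplitude
sets along a sparse subsequence; see the module docstring), and
`LiSinaiSeriesEnergyInfinite.of_expTilt` applies. No sign or shape information on the modes
and no control of cancellations between modes of different order is needed.
[cite: LiSinai2008, §10 p. 312 (first paragraph) and Thm. 1 p. 311] -/
theorem LiSinaiSeriesEnergyInfinite.of_modeLowerBound
    (h : ∃ (v₀ : EuclideanSpace ℝ (Fin 3) → EuclideanSpace ℝ (Fin 3)) (a R t ρ σ : ℝ),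
      0 < a ∧ 0 < t ∧ 0 < ρ ∧ 0 < σ ∧
      Measurable v₀ ∧ (∃ M : ℝ, ∀ k, ‖v₀ k‖ ≤ M) ∧ (∀ k, v₀ k ≠ 0 → a ≤ k 2 ∧ ‖k‖ ≤ R) ∧
      (∀ k, ⟪v₀ k, k⟫ = 0) ∧
      ∃ᶠ n : ℕ in atTop, ENNReal.ofReal (σ ^ n) ≤
        volume {k : EuclideanSpace ℝ (Fin 3) | ρ ^ n ≤ ‖mode v₀ n t k‖}) :
    LiSinaiSeriesEnergyInfinite := by
  classical
  obtain ⟨v₀, a, R, t, ρ, σ, ha, ht, hρ, hσ, hm, ⟨M₀, hM₀⟩, hsupp, hdiv, hfreq⟩ := h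
  -- the modes at time `t`, the big-mode sets `G n` and their geometry
  set G : ℕ → Set (EuclideanSpace ℝ (Fin 3)) := fun n => {k | ρ ^ n ≤ ‖mode v₀ n t k‖} with hG
  have hG_meas : ∀ n, MeasurableSet (G n) := fun n =>
    measurableSet_le measurable_const (measurable_mode_slice hm n t).norm
  have hG_supp : ∀ n, ∀ k ∈ G n, (n : ℝ) * a ≤ k 2 ∧ k 2 ≤ n * R ∧ ‖k‖ ≤ n * R := by
    intro n k hk
    have hne : mode v₀ n t k ≠ 0 := by
      intro h0
      have h1 : ρ ^ n ≤ 0 := by simpa [hG, h0] using hk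
      exact absurd h1 (not_le.2 (pow_pos hρ n))
    have h2 := mode_support hsupp n t k hne
    refine ⟨h2.1, ?_, h2.2⟩
    exact (le_abs_self _).trans
      ((by simpa using PiLp.norm_apply_le k 2 : |k 2| ≤ ‖k‖).trans h2.2)
  have hG_fin : ∀ n, volume (G n) ≠ ∞ := fun n =>
    ne_top_of_le_ne_top (measure_closedBall_lt_top (x := (0 : EuclideanSpace ℝ (Fin 3)))
      (r := n * R)).ne (measure_mono fun k hk => mem_closedBall_zero_iff.2 (hG_supp n k hk).2.2)
  -- `a ≤ R` (some `G n`, `n ≥ 1`, is nonempty)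
  have haR : a ≤ R := by
    obtain ⟨n, hn1, hn⟩ := hfreq.forall_exists_of_atTop 1
    have hpos : volume (G n) ≠ 0 := fun h0 => by
      have h1 : ENNReal.ofReal (σ ^ n) ≤ 0 := by rw [← h0]; exact hn
      exact absurd (ENNReal.ofReal_eq_zero.1 (le_antisymm h1 bot_le))
        (not_le.2 (pow_pos hσ n))
    obtain ⟨k, hk⟩ := nonempty_of_measure_ne_zero hpos
    have h1 := hG_supp n k hk
    have hn0 : (0 : ℝ) < n := by exact_mod_cast hn1
    nlinarith [h1.1, h1.2.1]
  have hR : 0 < R := ha.trans_le haR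
  -- truncation orders `N n` and the partial sums `V n A k`
  set N : ℕ → ℕ := fun n => ⌊(n : ℝ) * R / a⌋₊ + 1 with hN
  have hN_lt : ∀ n, ∀ k ∈ G n, k 2 < (N n : ℝ) * a := fun n k hk =>
    (hG_supp n k hk).2.1.trans_lt (lt_floor_succ_mul ha _)
  have hnN : ∀ n, ∀ k ∈ G n, n < N n := by
    intro n k hk
    have h1 : (n : ℝ) * a < N n * a := (hG_supp n k hk).1.trans_lt (hN_lt n k hk)
    exact_mod_cast lt_of_mul_lt_mul_right h1 ha.le
  set V : ℕ → ℝ → EuclideanSpace ℝ (Fin 3) → EuclideanSpace ℝ (Fin 3) :=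
    fun n A k => ∑ q ∈ Finset.range (N n), A ^ q • mode v₀ q t k with hV
  have hV_eq : ∀ n (A : ℝ), ∀ k ∈ G n, seriesSolution (fun k => A • v₀ k) t k = V n A k := by
    intro n A k hk
    have hsuppA : ∀ k, (fun k => A • v₀ k) k ≠ 0 → a ≤ k 2 ∧ ‖k‖ ≤ R := fun k hk0 =>
      hsupp k fun h0 => hk0 (by simp [h0])
    rw [seriesSolution_eq_sum ha hsuppA (hN_lt n k hk) t]
    refine Finset.sum_congr rfl fun q _ => ?_
    rw [mode_smul]
  have hV_meas : ∀ n, Measurable fun x : ℝ × EuclideanSpace ℝ (Fin 3) => V n x.1 x.2 := by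
    intro n
    refine Finset.measurable_sum _ fun q _ => ?_
    exact (measurable_fst.pow_const q).smul ((measurable_mode_slice hm q t).comp measurable_snd)
  -- the constants: `K = 72^{R/a}`, the thresholds `ε n`, the tilt `μ`
  set K : ℝ := (72 : ℝ) ^ (R / a) with hK
  have hK1 : 1 ≤ K := Real.one_le_rpow (by norm_num) (div_nonneg hR.le ha.le)
  have hK0 : 0 < K := one_pos.trans_le hK1
  have hK_pow : ∀ n, (72 : ℝ) ^ (N n - 1) ≤ K ^ n := by
    intro n
    have h1 : ((N n - 1 : ℕ) : ℝ) ≤ (n : ℝ) * (R / a) := by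
      simp only [hN, Nat.add_sub_cancel]
      rw [mul_div_assoc']
      exact Nat.floor_le (by positivity)
    calc (72 : ℝ) ^ (N n - 1) = (72 : ℝ) ^ ((N n - 1 : ℕ) : ℝ) := (Real.rpow_natCast _ _).symm
      _ ≤ (72 : ℝ) ^ ((n : ℝ) * (R / a)) := Real.rpow_le_rpow_of_exponent_le (by norm_num) h1
      _ = K ^ n := by rw [mul_comm, Real.rpow_mul (by norm_num), hK, Real.rpow_natCast]
  set ε : ℕ → ℝ := fun n => Real.sqrt 2 * (Real.sqrt σ)⁻¹ ^ n with hε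
  have hsσ : 0 < Real.sqrt σ := Real.sqrt_pos.2 hσ
  have hε0 : ∀ n, 0 ≤ ε n := fun n => by positivity
  have hε_sq : ∀ n, 2 ≤ ε n ^ 2 * σ ^ n := by
    intro n
    have h2 : ((Real.sqrt σ)⁻¹ ^ n) ^ 2 * σ ^ n = 1 := by
      rw [← pow_mul, mul_comm n 2, pow_mul, inv_pow, Real.sq_sqrt hσ.le, ← mul_pow,
        inv_mul_cancel₀ hσ.ne', one_pow]
    have h1 : ε n ^ 2 * σ ^ n = 2 := by
      simp only [hε]
      rw [mul_pow, Real.sq_sqrt (by norm_num : (0:ℝ) ≤ 2), mul_assoc, h2, mul_one]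
    rw [h1]
  set μ : ℝ := max 0 (Real.log (5 * K / (ρ * Real.sqrt σ)) / a) with hμ
  have hμ0 : 0 ≤ μ := le_max_left _ _
  have hexpμ : 5 * K / (ρ * Real.sqrt σ) ≤ Real.exp (μ * a) := by
    have h1 : Real.log (5 * K / (ρ * Real.sqrt σ)) ≤ μ * a := by
      have := le_max_right 0 (Real.log (5 * K / (ρ * Real.sqrt σ)) / a)
      rw [hμ]
      rwa [div_le_iff₀ ha] at this
    calc 5 * K / (ρ * Real.sqrt σ) = Real.exp (Real.log (5 * K / (ρ * Real.sqrt σ))) :=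
          (Real.exp_log (by positivity)).symm
      _ ≤ Real.exp (μ * a) := Real.exp_le_exp.2 h1
  -- the key numerical inequality: `3 · 72^{N n - 1} e^{-μ n a} ε n < ρ^n` for `n ≥ 1`
  have hkey : ∀ n, 1 ≤ n → 3 * (72 : ℝ) ^ (N n - 1) * (Real.exp (-(μ * (n * a))) * ε n) < ρ ^ n := by
    intro n hn
    set θ : ℝ := K * ((Real.exp (μ * a))⁻¹ * (Real.sqrt σ)⁻¹) with hθ
    have hθρ : θ ≤ ρ / 5 := by
      have he : 0 < Real.exp (μ * a) := Real.exp_pos _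
      have h2 : 5 * K ≤ Real.exp (μ * a) * (ρ * Real.sqrt σ) :=
        (div_le_iff₀ (by positivity)).1 hexpμ
      have h3 : θ * (5 * (Real.exp (μ * a) * Real.sqrt σ)) = 5 * K := by
        rw [hθ]
        field_simp
      rw [le_div_iff₀ (by norm_num : (0:ℝ) < 5)]
      have h4 : θ * 5 * (Real.exp (μ * a) * Real.sqrt σ) ≤
          ρ * (Real.exp (μ * a) * Real.sqrt σ) := by
        calc θ * 5 * (Real.exp (μ * a) * Real.sqrt σ)
            = θ * (5 * (Real.exp (μ * a) * Real.sqrt σ)) := by ring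
          _ = 5 * K := h3
          _ ≤ Real.exp (μ * a) * (ρ * Real.sqrt σ) := h2
          _ = ρ * (Real.exp (μ * a) * Real.sqrt σ) := by ring
      exact le_of_mul_le_mul_right h4 (by positivity)
    have hθ0 : 0 ≤ θ := by positivity
    have h1 : Real.exp (-(μ * (n * a))) = (Real.exp (μ * a))⁻¹ ^ n := by
      rw [← Real.exp_neg, ← Real.exp_nat_mul]
      congr 1
      ring
    calc 3 * (72 : ℝ) ^ (N n - 1) * (Real.exp (-(μ * (n * a))) * ε n)
        = 3 * Real.sqrt 2 * ((72 : ℝ) ^ (N n - 1) *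
            ((Real.exp (μ * a))⁻¹ ^ n * (Real.sqrt σ)⁻¹ ^ n)) := by
          rw [h1]; simp only [hε]; ring
      _ ≤ 3 * Real.sqrt 2 * (K ^ n * ((Real.exp (μ * a))⁻¹ ^ n * (Real.sqrt σ)⁻¹ ^ n)) := by
          gcongr
          exact hK_pow n
      _ = 3 * Real.sqrt 2 * θ ^ n := by rw [hθ, mul_pow, mul_pow]
      _ ≤ 3 * Real.sqrt 2 * (ρ / 5) ^ n := by gcongr
      _ = 3 * Real.sqrt 2 / 5 ^ n * ρ ^ n := by rw [div_pow]; ring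
      _ ≤ 3 * Real.sqrt 2 / 5 * ρ ^ n := by
          gcongr
          · exact le_self_pow₀ (by norm_num) (by omega)
      _ < 1 * ρ ^ n := by
          gcongr
          have h2 : Real.sqrt 2 < 3 / 2 := by
            rw [Real.sqrt_lt' (by norm_num)]
            norm_num
          linarith
      _ = ρ ^ n := one_mul _
  -- Step (2): at `k ∈ G n`, small amplitudes are rare
  have hsmall : ∀ n, 1 ≤ n → ∀ k ∈ G n,
      volume (Set.Icc (1 : ℝ) 2 ∩ {A : ℝ | ‖V n A k‖ ≤ Real.exp (-(μ * k 2)) * ε n}) ≤ 4⁻¹ := by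
    intro n hn k hk
    have hbig : 3 * (72 : ℝ) ^ (N n - 1) * (Real.exp (-(μ * k 2)) * ε n) < ‖mode v₀ n t k‖ := by
      refine lt_of_le_of_lt ?_ ((hkey n hn).trans_le hk)
      gcongr
      · exact (hG_supp n k hk).1
    have h1 := volume_smallAmplitude_lt (hnN n k hk) (hε0 n) hbig
    rw [show ENNReal.ofReal (1 / 4) = 4⁻¹ by
      rw [ENNReal.ofReal_div_of_pos (by norm_num), ENNReal.ofReal_one, ENNReal.ofReal_ofNat,
        one_div]] at h1
    exact h1.le
  -- Step (3): for each `n ≥ 1` with a big `G n`, good amplitudes form a set of measure `≥ 1/2`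
  set Z : ℕ → Set (ℝ × EuclideanSpace ℝ (Fin 3)) := fun n =>
    {x | x.1 ∈ Set.Icc (1 : ℝ) 2 ∧ x.2 ∈ G n ∧ ‖V n x.1 x.2‖ ≤ Real.exp (-(μ * x.2 2)) * ε n}
    with hZ
  have hZ_meas : ∀ n, MeasurableSet (Z n) := by
    intro n
    simp only [hZ, Set.setOf_and]
    refine (measurableSet_Icc.preimage measurable_fst).inter
      (((hG_meas n).preimage measurable_snd).inter ?_)
    refine measurableSet_le (hV_meas n).norm ?_
    exact ((Real.continuous_exp.measurable.comp (by fun_prop : Measurable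
      fun x : ℝ × EuclideanSpace ℝ (Fin 3) => -(μ * x.2 2))).mul measurable_const)
  set B : ℕ → Set ℝ := fun n =>
    Set.Icc (1 : ℝ) 2 ∩ {A : ℝ | volume (Prod.mk A ⁻¹' Z n) < volume (G n) / 2} with hB
  have hB_meas : ∀ n, MeasurableSet (B n) := fun n =>
    measurableSet_Icc.inter (measurableSet_lt (measurable_measure_prodMk_left (hZ_meas n))
      measurable_const)
  have hB_sub : ∀ n, B n ⊆ Set.Icc (1 : ℝ) 2 := fun n => Set.inter_subset_left
  have hB_vol : ∀ n, 1 ≤ n → ENNReal.ofReal (σ ^ n) ≤ volume (G n) → 2⁻¹ ≤ volume (B n) := by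
    intro n hn hGσ
    have hG0 : volume (G n) ≠ 0 := fun h0 => by
      rw [h0] at hGσ
      exact absurd (ENNReal.ofReal_eq_zero.1 (le_antisymm hGσ bot_le))
        (not_le.2 (pow_pos hσ n))
    refine half_le_volume_goodAmplitudes (hG_meas n) hG0 (hG_fin n) (hZ_meas n)
      (fun x hx => hx.2.1) fun k hk => ?_
    have hsec : (fun A : ℝ => (A, k)) ⁻¹' Z n ⊆
        Set.Icc (1 : ℝ) 2 ∩ {A : ℝ | ‖V n A k‖ ≤ Real.exp (-(μ * k 2)) * ε n} :=
      fun A hA => ⟨hA.1, hA.2.2⟩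
    exact (measure_mono hsec).trans (hsmall n hn k hk)
  -- energy `≥ 1` on `G n` for good amplitudes
  have hunit : ∀ n (A : ℝ), A ∈ B n → ENNReal.ofReal (σ ^ n) ≤ volume (G n) →
      1 ≤ ∫⁻ k in G n, ‖Real.exp (μ * k 2) • V n A k‖ₑ ^ 2 := by
    intro n A hA hGσ
    have hW : Measurable fun k => V n A k :=
      (hV_meas n).comp (measurable_const.prodMk measurable_id)
    have hw : Measurable fun k : EuclideanSpace ℝ (Fin 3) => Real.exp (μ * k 2) := by fun_prop
    refine one_le_setLIntegral_weighted (hG_meas n) hGσ hW hw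
      (fun k => Real.exp_pos _) (hε0 n) (hε_sq n) ?_
    have hset : G n ∩ {k | ‖V n A k‖ ≤ (Real.exp (μ * k 2))⁻¹ * ε n} = Prod.mk A ⁻¹' Z n := by
      ext k
      simp only [hZ, Set.mem_inter_iff, Set.mem_setOf_eq, Set.mem_preimage, Real.exp_neg]
      exact ⟨fun h => ⟨hA.1, h.1, h.2⟩, fun h => ⟨h.2.1, h.2.2⟩⟩
    rw [hset]
    exact hA.2
  -- Step (4): a sparse subsequence of big-mode orders, and one amplitude good for
  -- infinitely many of them
  obtain ⟨idx, hidxP, hidx0, hidx_next⟩ := exists_seq_of_frequently hfreq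
    (fun m => ⌊(m : ℝ) * R / a⌋₊ + 1) 1
  have hidx_gap : ∀ j, (idx j : ℝ) * R < idx (j + 1) * a := by
    intro j
    have h1 := lt_floor_succ_mul ha ((idx j : ℝ) * R)
    refine h1.trans_le ?_
    gcongr
    exact_mod_cast hidx_next j
  have hidx_mono : StrictMono idx := by
    refine strictMono_nat_of_lt_succ fun j => ?_
    have h1 : (idx j : ℝ) * R < idx (j + 1) * R :=
      (hidx_gap j).trans_le (mul_le_mul_of_nonneg_left haR (Nat.cast_nonneg _))
    exact_mod_cast lt_of_mul_lt_mul_right h1 hR.le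
  have hidx1 : ∀ j, 1 ≤ idx j := fun j => hidx0.trans (hidx_mono.monotone (Nat.zero_le j))
  have hdisj : Pairwise (Function.onFun Disjoint fun j => G (idx j)) := by
    intro j j' hjj'
    wlog hlt : j < j' generalizing j j'
    · exact (this hjj'.symm (lt_of_le_of_ne (not_lt.1 hlt) hjj'.symm)).symm
    refine Set.disjoint_left.2 fun k hk hk' => ?_
    have h1 := (hG_supp _ k hk).2.1      -- k 2 ≤ idx j * R
    have h2 := (hG_supp _ k hk').1       -- idx j' * a ≤ k 2
    have h3 : (idx (j + 1) : ℝ) * a ≤ idx j' * a := by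
      gcongr
      exact_mod_cast hidx_mono.monotone (Nat.succ_le_of_lt hlt)
    linarith [hidx_gap j]
  obtain ⟨A, hA⟩ := exists_mem_frequently (fun j => hB_meas (idx j)) (fun j => hB_sub (idx j))
    fun j => hB_vol (idx j) (hidx1 j) (hidxP j)
  -- the weighted energy of `A v₀` is infinite
  set c : EuclideanSpace ℝ (Fin 3) := μ • EuclideanSpace.single (2 : Fin 3) (1 : ℝ) with hc
  have hinner : ∀ k : EuclideanSpace ℝ (Fin 3), ⟪c, k⟫ = μ * k 2 := by
    intro k
    rw [hc, real_inner_smul_left, EuclideanSpace.inner_single_left]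
    simp
  have hJ : {j : ℕ | A ∈ B (idx j)}.Infinite :=
    Set.infinite_of_forall_exists_gt fun M => by
      obtain ⟨j, hj, hAj⟩ := hA (M + 1)
      exact ⟨j, hAj, Nat.lt_of_succ_le hj⟩
  have htop : ∫⁻ k, ‖Real.exp ⟪c, k⟫ • seriesSolution (fun k => A • v₀ k) t k‖ₑ ^ 2 = ∞ := by
    refine lintegral_eq_top_of_disjoint (fun j => hG_meas (idx j)) hdisj hJ fun j hj => ?_
    refine (hunit (idx j) A hj (hidxP j)).trans (le_of_eq ?_)
    refine setLIntegral_congr_fun (hG_meas _) fun k hk => ?_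
    rw [hinner, hV_eq _ A k hk]
  -- conclude by the weighted-energy criterion
  have hM₀' : 0 ≤ M₀ := (norm_nonneg _).trans (hM₀ 0)
  refine LiSinaiSeriesEnergyInfinite.of_expTilt ⟨fun k => A • v₀ k, a, R, t, c, ha, ht,
    hm.const_smul A, ⟨|A| * M₀, fun k => ?_⟩, ?_, fun k => ?_, htop⟩
  · rw [norm_smul, Real.norm_eq_abs]
    exact mul_le_mul_of_nonneg_left (hM₀ k) (abs_nonneg A)
  · exact fun k hk0 => hsupp k fun h0 => hk0 (by simp [h0])
  · rw [real_inner_smul_left, hdiv, mul_zero]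

/-- **Single-mode criterion for the narrowed catalogue form**: the hypothesis of
`LiSinaiSeriesEnergyInfinite.of_modeLowerBound` already gives
`LiSinaiCriticalEnergyBlowupNarrow` (via `LiSinaiSeriesEnergyInfinite.criticalEnergyBlowupNarrow`).
[folklore] -/
theorem LiSinaiCriticalEnergyBlowupNarrow.of_modeLowerBound
    (h : ∃ (v₀ : EuclideanSpace ℝ (Fin 3) → EuclideanSpace ℝ (Fin 3)) (a R t ρ σ : ℝ),
      0 < a ∧ 0 < t ∧ 0 < ρ ∧ 0 < σ ∧
      Measurable v₀ ∧ (∃ M : ℝ, ∀ k, ‖v₀ k‖ ≤ M) ∧ (∀ k, v₀ k ≠ 0 → a ≤ k 2 ∧ ‖k‖ ≤ R) ∧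
      (∀ k, ⟪v₀ k, k⟫ = 0) ∧
      ∃ᶠ n : ℕ in atTop, ENNReal.ofReal (σ ^ n) ≤
        volume {k : EuclideanSpace ℝ (Fin 3) | ρ ^ n ≤ ‖mode v₀ n t k‖}) :
    LiSinaiCriticalEnergyBlowupNarrow :=
  (LiSinaiSeriesEnergyInfinite.of_modeLowerBound h).criticalEnergyBlowupNarrow

end Literature.Barriers.NavierStokesRegularity
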